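import Mathlib
import Literature.NumberTheory.Automorphic.ResGLnConeDictionaryCone
import Literature.NumberTheory.Automorphic.ResGLnConeEntryGaugeBounds
import Literature.NumberTheory.Automorphic.ResGLnConeGlobalGrowthTransfer
import Summits.Langlands.Langlands.Theorems.IrreducibilityBySelfDualityHeckeEigenvalueFieldStubReducedCover
import Summits.Langlands.Langlands.Theorems.IrreducibilityBySelfDualityHeckeEigenvalueFieldStubConeGrowthCoeff
import Summits.Langlands.Langlands.Theorems.IrreducibilityBySelfDualityHeckeEigenvalueFieldStubRedBound
import HarnessLib

/-!
# Polynomial `C¹` growth on the whole cone from growth on reduced sets — crux HeckeEigenvalueField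
# (stmt-Langlands-13632), line Sketch, stub `stub_global_growth` (GLOBAL-GROWTH)

Namespace `Summit.Langlands.Langlands.Theorems.HeckeEigenvalueField.Res`; theorems only.

An equivariant family `β c` of smooth `q`-forms on the positive cone `X = posCone n K` with values in
`E_λ(ℂ) ⊗ ε_S`, with `C¹` bounds `≤ C E(H)^k` (`E(H) = 1 + ∑ (‖H_ij‖ + ‖H⁻¹_ij‖)`) on the reduced sets
`R(p)`, has such bounds on all of `X`, coset by coset:

* generic layer (`Literature/…/ResGLnConeGlobalGrowthTransfer.lean`, `ConeGlobalGrowth.transfer_bound`):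
  for `ι g • c' = c` the equivariance moves `β c` at `x` to `β c'` at `g⁻¹ · x` (value AND derivative),
  whence `‖β c x‖ ≤ A R B^q`, `‖D(β c) x‖ ≤ A R B^{q+1}` from `‖ρ g‖ ≤ A`, `‖a g⁻¹‖ ≤ B` and the
  bound `R` of `β c'` at `g⁻¹ · x`; the real bookkeeping (`numeric`, `arith`) lives there too;
* specific layer (here): cover `X = ⋃ (γ t) · R(p₀)` over the arithmetic stabiliser of `c` and a finite `T`
  (landed COVER-FIN), entries of `γ^{±1}` polynomial in `E(H)` (RED-BOUND), coefficient growth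
  `‖(E_λ ⊗ ε_S)(g)‖ ≤ C sz(g)^k` (landed `stub_coneGrowth_coeffRep`), `E(g⁻¹ · H) ≤ sz² E(H)` and
  `‖g⁻¹ · v‖ ≤ n² sz² ‖v‖` by entry sums.

References: A. Borel, *Regularization theorems in Lie algebra cohomology*, Duke Math. J. 50 (1983), §3.5
[Borel1983Regularization]; A. Borel, N. Wallach, *Continuous cohomology, discrete subgroups, and
representations of reductive groups* (2000), VII 2.2 [BorelWallach2000].
-/

set_option linter.dupNamespace false -- project-wide: `Summit.Langlands.Langlands` is the mandated namespace

noncomputable section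

open scoped Matrix.Norms.Operator Topology Classical Matrix TensorProduct
open Filter Set NumberField NumberField.mixedEmbedding Literature.NumberTheory.Automorphic

-- calculus of form-valued maps on the cone needs ONE topology on `hermSpace n K` (the normed one), as in
-- the lead's skeleton and the landed FAM-EXT file
attribute [-instance] instTopologicalSpaceMatrix
attribute [-instance] Matrix.instUniformSpace
attribute [local instance high] NormedAddCommGroup.toSeminormedAddCommGroup

namespace Summit.Langlands.Langlands.Theorems.HeckeEigenvalueField.Res

-- the registered header is stated over these namespaces (lead's skeleton)
open ResGLnCohomology BigHeckeGLn ResGLnCone ConeDictionary SiegelFamily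

namespace GlobalGrowth

variable {n : ℕ} {K : Type} [Field K] [NumberField K]

/-- **Uniform polynomial growth of `σS ∘ diagArch`** in the entry gauge of `θ(A)^{±1}` (landed
coefficient growth `stub_coneGrowth_coeffRep` for the size `1 + ∑ (‖g_ij‖ + ‖g⁻¹_ij‖)` on `G_∞`).
[cite: BorelWallach2000, VII §2.2] -/
theorem sigma_growth (hcpt : isCompact_glFiniteIntegralLevel n K)
    (S : Finset {w : InfinitePlace K // w.IsReal}) (lam : (K →+* ℂ) → Fin n → ℤ) :
    ∃ (C : ℝ) (k : ℕ), 0 ≤ C ∧ ∀ (A : GL (Fin n) K) (Y : CoeffModule ℂ n K lam),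
      ‖σS hcpt S lam (ParallelWeight.diagArch K n A) Y‖ ≤
        C * (1 + ∑ i, ∑ j, (‖(toMixedGL n K A).1 i j‖ + ‖(toMixedGL n K A⁻¹).1 i j‖)) ^ k * ‖Y‖ := by
  have hnn : ∀ (g : (archGroupGL n K).carrier) (i j : Fin n),
      0 ≤ ‖(g : GL (Fin n) (mixedSpace K)).1 i j‖ := fun _ _ _ => norm_nonneg _
  have hnn' : ∀ (g : (archGroupGL n K).carrier) (i j : Fin n),
      0 ≤ ‖((g⁻¹ : (archGroupGL n K).carrier) : GL (Fin n) (mixedSpace K)).1 i j‖ :=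
    fun _ _ _ => norm_nonneg _
  obtain ⟨C, k, hC, h⟩ := stub_coneGrowth_coeffRep n K
    (fun g => 1 + ∑ i, ∑ j, (‖(g : GL (Fin n) (mixedSpace K)).1 i j‖ +
      ‖((g⁻¹ : (archGroupGL n K).carrier) : GL (Fin n) (mixedSpace K)).1 i j‖))
    (fun g => le_add_of_nonneg_right (Finset.sum_nonneg fun i _ => Finset.sum_nonneg fun j _ =>
      add_nonneg (hnn g i j) (hnn' g i j)))
    (fun g i j => ((ConeGlobalGrowth.single_le_sum₂ (hnn g) (hnn' g) i j).1).trans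
      (le_add_of_nonneg_left zero_le_one))
    (fun g i j => ((ConeGlobalGrowth.single_le_sum₂ (hnn g) (hnn' g) i j).2).trans
      (le_add_of_nonneg_left zero_le_one))
    S lam
  refine ⟨C, k, hC, fun A Y => ?_⟩
  have h1 := h (ParallelWeight.diagArch K n A) Y
  simp only [← map_inv] at h1
  exact h1

end GlobalGrowth

/-- **GLOBAL-GROWTH for one coset, from a reduced cover and the reducing-element bound.**  Given the
cover `X = ⋃_{γ ∈ Γ_c, t ∈ T} (γ t) · R(p₀)` and polynomial bounds for the reducing `γ^{±1}`, an
equivariant smooth family with polynomial `C¹` bounds on reduced sets has polynomial `C¹` bounds on the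
whole cone at the coset `c`. [cite: Borel1983Regularization, §3.5] -/
theorem global_growth_of_cover {n : ℕ} {K : Type} [Field K] [NumberField K]
    (hcpt : isCompact_glFiniteIntegralLevel n K) (𝔫 : Ideal (𝓞 K))
    (S : Finset {w : InfinitePlace K // w.IsReal}) (lam : (K →+* ℂ) → Fin n → ℤ) {q : ℕ}
    (β : (FiniteAdelicGL n K ⧸ level n K 𝔫) → hermSpace n K → (hermSpace n K [⋀^Fin q]→L[ℝ] CoeffModule ℂ n K lam))
    (hβs : ∀ c, ContDiffOn ℝ ((⊤ : ℕ∞) : WithTop ℕ∞) (β c) (posCone n K))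
    (hβe : ∀ (γ : GL (Fin n) K) (c : FiniteAdelicGL n K ⧸ level n K 𝔫),
        ∀ H ∈ posCone n K, ∀ v : Fin q → hermSpace n K,
        β (globalEmbedding n K γ • c) (coneActionRat n K γ H) (fun i => coneActionRat n K γ (v i)) =
          σS hcpt S lam (ParallelWeight.diagArch K n γ) (β c H v))
    (hβb : ∀ (c : FiniteAdelicGL n K ⧸ level n K 𝔫) (c₁ C₁ τ₁ : ℝ),
        ∃ (C : ℝ) (k : ℕ), ∀ H ∈ posCone n K,
          IsReduced c₁ C₁ τ₁ n (placeFamily K (H : Matrix (Fin n) (Fin n) (mixedSpace K))) →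
            ∀ (v : Fin q → hermSpace n K) (w' : hermSpace n K),
              ‖β c H v‖ ≤ C * (1 + ∑ i, ∑ j,
              (‖(H : Matrix (Fin n) (Fin n) (mixedSpace K)) i j‖ +
                ‖(H : Matrix (Fin n) (Fin n) (mixedSpace K))⁻¹ i j‖)) ^ k * ∏ i, ‖v i‖ ∧
              ‖fderiv ℝ (β c) H w' v‖ ≤ C * (1 + ∑ i, ∑ j,
              (‖(H : Matrix (Fin n) (Fin n) (mixedSpace K)) i j‖ +
                ‖(H : Matrix (Fin n) (Fin n) (mixedSpace K))⁻¹ i j‖)) ^ k * ‖w'‖ * ∏ i, ‖v i‖)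
    (c : FiniteAdelicGL n K ⧸ level n K 𝔫) {c₀ C₀ τ₀ : ℝ} {T : Finset (GL (Fin n) K)}
    (hcov : ∀ H ∈ posCone n K, ∃ γ : glTotPos n K, diagPos n K γ • c = c ∧ ∃ t ∈ T,
      IsReduced c₀ C₀ τ₀ n (placeFamily K
        ((coneActionRat n K ((γ : GL (Fin n) K) * t)⁻¹ H : hermSpace n K) : Matrix (Fin n) (Fin n) (mixedSpace K))))
    (hred : ∃ (C : ℝ) (k : ℕ), ∀ H ∈ posCone n K, ∀ (γ : glTotPos n K), diagPos n K γ • c = c →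
      ∀ t ∈ T, IsReduced c₀ C₀ τ₀ n (placeFamily K
          ((coneActionRat n K (((γ : GL (Fin n) K)) * t)⁻¹ H : hermSpace n K) :
            Matrix (Fin n) (Fin n) (mixedSpace K))) →
        ∀ i j : Fin n,
          ‖mixedEmbedding K (((γ : GL (Fin n) K) : Matrix (Fin n) (Fin n) K) i j)‖ ≤ C * (1 + ∑ i, ∑ j,
              (‖(H : Matrix (Fin n) (Fin n) (mixedSpace K)) i j‖ +
                ‖(H : Matrix (Fin n) (Fin n) (mixedSpace K))⁻¹ i j‖)) ^ k ∧
          ‖mixedEmbedding K (((γ : GL (Fin n) K)⁻¹ : Matrix (Fin n) (Fin n) K) i j)‖ ≤ C * (1 + ∑ i, ∑ j,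
              (‖(H : Matrix (Fin n) (Fin n) (mixedSpace K)) i j‖ +
                ‖(H : Matrix (Fin n) (Fin n) (mixedSpace K))⁻¹ i j‖)) ^ k) :
    ∃ (C : ℝ) (k : ℕ), ∀ H ∈ posCone n K, ∀ (v : Fin q → hermSpace n K) (w' : hermSpace n K),
      ‖β c H v‖ ≤ C * (1 + ∑ i, ∑ j,
            (‖(H : Matrix (Fin n) (Fin n) (mixedSpace K)) i j‖ +
              ‖(H : Matrix (Fin n) (Fin n) (mixedSpace K))⁻¹ i j‖)) ^ k * ∏ i, ‖v i‖ ∧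
      ‖fderiv ℝ (β c) H w' v‖ ≤ C * (1 + ∑ i, ∑ j,
            (‖(H : Matrix (Fin n) (Fin n) (mixedSpace K)) i j‖ +
              ‖(H : Matrix (Fin n) (Fin n) (mixedSpace K))⁻¹ i j‖)) ^ k * ‖w'‖ * ∏ i, ‖v i‖ := by
  obtain ⟨CR, kR, hCR⟩ := hred
  obtain ⟨Cσ, kσ, hCσ0, hσ⟩ := GlobalGrowth.sigma_growth hcpt S lam
  -- the transfer, with the numeric data left open; then the big hypotheses may be dropped
  have hTB := fun (g : GL (Fin n) K) (c' : FiniteAdelicGL n K ⧸ level n K 𝔫)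
      (hc : globalEmbedding n K g • c' = c) (H : hermSpace n K) (hH : H ∈ posCone n K) (A₀ B₀ R₀ : ℝ) =>
    ConeGlobalGrowth.transfer_bound (A := A₀) (B := B₀) (R := R₀) (globalEmbedding n K) (level n K 𝔫)
      ((σS hcpt S lam).comp
        (show GL (Fin n) K →* (AutomorphyDatum.gl n K hcpt).arch.carrier from ParallelWeight.diagArch K n))
      (coneActionRat n K) (isOpen_posCone n K) (mapsTo_coneActionRat_posCone n K) β hβs hβe g hc hH
  -- reduced-set constants of the cosets `t⁻¹ • c`, uniformised over `T`
  choose Cb kb hCb using fun t : GL (Fin n) K => hβb (globalEmbedding n K t⁻¹ • c) c₀ C₀ τ₀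
  clear hβs hβe hβb
  have hCbm0 : 0 ≤ ∑ t ∈ T, max (Cb t) 0 := Finset.sum_nonneg fun t _ => le_max_right _ _
  -- a uniform bound `Bt` for the entries of `θ(t)^{±1}`, `t ∈ T`; `R₁ = max C_R 1`; `D`, `N`
  obtain ⟨Bt, hBt⟩ : ∃ Bt : ℝ, Bt = 1 + ∑ t ∈ T, ∑ i, ∑ j,
      (‖mixedEmbedding K ((t : Matrix (Fin n) (Fin n) K) i j)‖ +
        ‖mixedEmbedding K (((t⁻¹ : GL (Fin n) K) : Matrix (Fin n) (Fin n) K) i j)‖) := ⟨_, rfl⟩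
  have hmE : ∀ (t : GL (Fin n) K) (i j : Fin n),
      0 ≤ ‖mixedEmbedding K ((t : Matrix (Fin n) (Fin n) K) i j)‖ := fun _ _ _ => norm_nonneg _
  have hmE' : ∀ (t : GL (Fin n) K) (i j : Fin n),
      0 ≤ ‖mixedEmbedding K (((t⁻¹ : GL (Fin n) K) : Matrix (Fin n) (Fin n) K) i j)‖ :=
    fun _ _ _ => norm_nonneg _
  have hBt0 : 0 ≤ Bt := by
    rw [hBt]
    exact add_nonneg zero_le_one (Finset.sum_nonneg fun t _ => Finset.sum_nonneg fun i _ =>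
      Finset.sum_nonneg fun j _ => add_nonneg (hmE t i j) (hmE' t i j))
  have hR₁1 : 1 ≤ max CR 1 := le_max_right _ _
  obtain ⟨D, hD⟩ : ∃ D : ℝ, D = 1 + 2 * (n : ℝ) ^ 3 * max CR 1 * Bt := ⟨_, rfl⟩
  obtain ⟨N, hN⟩ : ∃ N : ℝ, N = 1 + (n : ℝ) ^ 2 := ⟨_, rfl⟩
  refine ⟨Cσ * (∑ t ∈ T, max (Cb t) 0) * (N * D ^ 2) ^ (kσ + T.sup kb + q + 1),
    (2 * kR + 1) * (kσ + T.sup kb + q + 1), fun H hH v w' => ?_⟩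
  obtain ⟨γ, hγc, t, htT, hredM⟩ := hcov H hH
  clear hcov
  -- the size `e` of `H`, RED-BOUND for `γ^{±1}`, the finite set for `t^{±1}`
  have he1 := ResGLnCone.one_le_entryGauge (H : Matrix (Fin n) (Fin n) (mixedSpace K))
  set e : ℝ := 1 + ∑ i, ∑ j, (‖(H : Matrix (Fin n) (Fin n) (mixedSpace K)) i j‖ +
    ‖(H : Matrix (Fin n) (Fin n) (mixedSpace K))⁻¹ i j‖) with he_def
  have he0 : 0 ≤ e := zero_le_one.trans he1
  have hRγ := hCR H hH γ hγc t htT hredM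
  clear hCR
  have hγ1 : ∀ i j, ‖mixedEmbedding K (((γ : GL (Fin n) K) : Matrix (Fin n) (Fin n) K) i j)‖ ≤
      max CR 1 * e ^ kR :=
    fun i j => ((hRγ i j).1).trans (mul_le_mul_of_nonneg_right (le_max_left _ _) (pow_nonneg he0 _))
  have hγ2 : ∀ i j, ‖mixedEmbedding K (((γ : GL (Fin n) K)⁻¹ : Matrix (Fin n) (Fin n) K) i j)‖ ≤
      max CR 1 * e ^ kR :=
    fun i j => ((hRγ i j).2).trans (mul_le_mul_of_nonneg_right (le_max_left _ _) (pow_nonneg he0 _))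
  have ht1 : ∀ i j, ‖mixedEmbedding K ((t : Matrix (Fin n) (Fin n) K) i j)‖ ≤ Bt :=
    fun i j => by rw [hBt]; exact (ConeGlobalGrowth.le_one_add_sum_of_mem hmE hmE' htT i j).1
  have ht2 : ∀ i j, ‖mixedEmbedding K (((t⁻¹ : GL (Fin n) K) : Matrix (Fin n) (Fin n) K) i j)‖ ≤ Bt :=
    fun i j => by rw [hBt]; exact (ConeGlobalGrowth.le_one_add_sum_of_mem hmE hmE' htT i j).2
  -- the reducing element `A = γ t`: its coset identity, the reduced point `A⁻¹ · H`
  have hγc' : globalEmbedding n K (γ : GL (Fin n) K) • c = c := hγc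
  have hAc : globalEmbedding n K ((γ : GL (Fin n) K) * t) • (globalEmbedding n K t⁻¹ • c) = c := by
    rw [map_mul, mul_smul, map_inv, smul_inv_smul]
    exact hγc'
  have hM : coneActionRat n K ((γ : GL (Fin n) K) * t)⁻¹ H ∈ posCone n K :=
    mapsTo_coneActionRat_posCone n K _ hH
  -- entries of `θ(A)^{±1}` and the gauge `s` of `θ(A)^{±1}`
  have hA1 : ∀ i j, ‖(toMixedGL n K ((γ : GL (Fin n) K) * t)).1 i j‖ ≤
      n * (max CR 1 * e ^ kR * Bt) := fun i j => by
    rw [coe_toMixedGL, Matrix.map_apply, Units.val_mul]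
    exact ConeGlobalGrowth.entry_mul_le (mul_nonneg (zero_le_one.trans hR₁1) (pow_nonneg he0 _)) hγ1 ht1 i j
  have hA2 : ∀ i j, ‖(toMixedGL n K ((γ : GL (Fin n) K) * t)⁻¹).1 i j‖ ≤
      n * (max CR 1 * e ^ kR * Bt) := fun i j => by
    rw [mul_inv_rev, coe_toMixedGL, Matrix.map_apply, Units.val_mul, Matrix.coe_units_inv (γ : GL (Fin n) K)]
    have hmul : (n : ℝ) * (Bt * (max CR 1 * e ^ kR)) = n * (max CR 1 * e ^ kR * Bt) := by ring
    exact (ConeGlobalGrowth.entry_mul_le hBt0 ht2 hγ2 i j).trans hmul.le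
  have hsle := ConeGlobalGrowth.gauge_le_of_entry_le hA1 hA2
  set s : ℝ := 1 + ∑ i, ∑ j, (‖(toMixedGL n K ((γ : GL (Fin n) K) * t)).1 i j‖ +
    ‖(toMixedGL n K ((γ : GL (Fin n) K) * t)⁻¹).1 i j‖) with hs_def
  have hS'0 : 0 ≤ ∑ i, ∑ j, ‖(toMixedGL n K ((γ : GL (Fin n) K) * t)⁻¹).1 i j‖ :=
    Finset.sum_nonneg fun _ _ => Finset.sum_nonneg fun _ _ => norm_nonneg _
  have hS's : ∑ i, ∑ j, ‖(toMixedGL n K ((γ : GL (Fin n) K) * t)⁻¹).1 i j‖ ≤ s :=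
    (Finset.sum_le_sum fun i _ => Finset.sum_le_sum fun j _ => le_add_of_nonneg_left (norm_nonneg _)).trans
      (le_add_of_nonneg_left zero_le_one)
  have hs1 : 1 ≤ s := le_add_of_nonneg_right (Finset.sum_nonneg fun _ _ => Finset.sum_nonneg fun _ _ =>
    add_nonneg (norm_nonneg _) (norm_nonneg _))
  have hs0 : 0 ≤ s := zero_le_one.trans hs1
  -- the gauge of the reduced point `M = A⁻¹ · H`
  have hEM1 := ResGLnCone.one_le_entryGauge (coneActionRat n K ((γ : GL (Fin n) K) * t)⁻¹ H).1
  have hEMs := ConeGlobalGrowth.gauge_translate_le ((γ : GL (Fin n) K) * t) H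
  set EM : ℝ := 1 + ∑ i, ∑ j, (‖(coneActionRat n K ((γ : GL (Fin n) K) * t)⁻¹ H).1 i j‖ +
    ‖(coneActionRat n K ((γ : GL (Fin n) K) * t)⁻¹ H).1⁻¹ i j‖) with hEM_def
  have hEM0 : 0 ≤ EM := zero_le_one.trans hEM1
  -- the single base `u`
  obtain ⟨u, hu⟩ : ∃ u : ℝ, u = N * D ^ 2 * e ^ (2 * kR + 1) := ⟨_, rfl⟩
  obtain ⟨hu1, hsu, hEMu, hBu⟩ := ConeGlobalGrowth.numeric hR₁1 hBt0 he1 hS'0 hS's hs1 hsle hEMs hD hN hu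
  -- (1) the twist, (2) the linear maps `A⁻¹ ·`, (3) the reduced bound at `M` for the coset `t⁻¹ • c`
  have hAσ : ∀ Y : CoeffModule ℂ n K lam,
      ‖σS hcpt S lam (ParallelWeight.diagArch K n ((γ : GL (Fin n) K) * t)) Y‖ ≤ Cσ * s ^ kσ * ‖Y‖ :=
    fun Y => hσ _ Y
  have hAu : Cσ * s ^ kσ ≤ Cσ * u ^ kσ := mul_le_mul_of_nonneg_left (pow_le_pow_left₀ hs0 hsu kσ) hCσ0
  have hB1 : (1 : ℝ) ≤
      1 + (n : ℝ) ^ 2 * (∑ i, ∑ j, ‖(toMixedGL n K ((γ : GL (Fin n) K) * t)⁻¹).1 i j‖) ^ 2 :=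
    le_add_of_nonneg_right (mul_nonneg (sq_nonneg _) (sq_nonneg _))
  have hBy : ∀ y : hermSpace n K, ‖coneActionRat n K ((γ : GL (Fin n) K) * t)⁻¹ y‖ ≤
      (1 + (n : ℝ) ^ 2 * (∑ i, ∑ j, ‖(toMixedGL n K ((γ : GL (Fin n) K) * t)⁻¹).1 i j‖) ^ 2) * ‖y‖ :=
    fun y => (ConeGlobalGrowth.norm_coneActionRat_le _ y).trans (by
      rw [add_mul, one_mul]
      exact le_add_of_nonneg_left (norm_nonneg _))
  have hco : Cb t * EM ^ kb t ≤ (∑ t ∈ T, max (Cb t) 0) * EM ^ T.sup kb := by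
    have h1 : max (Cb t) 0 ≤ ∑ t ∈ T, max (Cb t) 0 :=
      Finset.single_le_sum (f := fun t => max (Cb t) 0) (fun t _ => le_max_right _ _) htT
    calc Cb t * EM ^ kb t ≤ max (Cb t) 0 * EM ^ kb t :=
          mul_le_mul_of_nonneg_right (le_max_left _ _) (pow_nonneg hEM0 _)
      _ ≤ (∑ t ∈ T, max (Cb t) 0) * EM ^ T.sup kb :=
          mul_le_mul h1 (pow_le_pow_right₀ hEM1 (Finset.le_sup htT)) (pow_nonneg hEM0 _) hCbm0
  have hRb : ∀ (v' : Fin q → hermSpace n K) (w'' : hermSpace n K),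
      ‖β (globalEmbedding n K t⁻¹ • c) (coneActionRat n K ((γ : GL (Fin n) K) * t)⁻¹ H) v'‖ ≤
        (∑ t ∈ T, max (Cb t) 0) * EM ^ T.sup kb * ∏ i, ‖v' i‖ ∧
      ‖fderiv ℝ (β (globalEmbedding n K t⁻¹ • c)) (coneActionRat n K ((γ : GL (Fin n) K) * t)⁻¹ H)
          w'' v'‖ ≤ (∑ t ∈ T, max (Cb t) 0) * EM ^ T.sup kb * ‖w''‖ * ∏ i, ‖v' i‖ := by
    intro v' w''
    obtain ⟨h1, h2⟩ := hCb t _ hM hredM v' w''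
    rw [← hEM_def] at h1 h2
    have hP : 0 ≤ ∏ i, ‖v' i‖ := Finset.prod_nonneg fun _ _ => norm_nonneg _
    refine ⟨h1.trans (mul_le_mul_of_nonneg_right hco hP), h2.trans ?_⟩
    rw [mul_assoc, mul_assoc ((∑ t ∈ T, max (Cb t) 0) * EM ^ T.sup kb)]
    exact mul_le_mul_of_nonneg_right hco (mul_nonneg (norm_nonneg _) hP)
  have hRu : (∑ t ∈ T, max (Cb t) 0) * EM ^ T.sup kb ≤ (∑ t ∈ T, max (Cb t) 0) * u ^ T.sup kb :=
    mul_le_mul_of_nonneg_left (pow_le_pow_left₀ hEM0 hEMu _) hCbm0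
  -- transfer and bookkeeping
  obtain ⟨hv, hd⟩ := hTB _ _ hAc H hH _ _ _ (mul_nonneg hCσ0 (pow_nonneg hs0 kσ)) hAσ (zero_le_one.trans hB1)
    hBy (mul_nonneg hCbm0 (pow_nonneg hEM0 _)) hRb v w'
  have hP0 : 0 ≤ ∏ i, ‖v i‖ := Finset.prod_nonneg fun _ _ => norm_nonneg _
  obtain ⟨k1, k2⟩ := ConeGlobalGrowth.arith (P := ∏ i, ‖v i‖) (q := q) hu1
    (mul_nonneg hCσ0 (pow_nonneg hs0 kσ)) hAu (mul_nonneg hCbm0 (pow_nonneg hEM0 _)) hRu hB1 hBu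
    (norm_nonneg w') hP0
  have hum : u ^ (kσ + T.sup kb + q + 1) =
      (N * D ^ 2) ^ (kσ + T.sup kb + q + 1) * e ^ ((2 * kR + 1) * (kσ + T.sup kb + q + 1)) := by
    rw [hu, mul_pow, ← pow_mul]
  rw [hum] at k1 k2
  exact ⟨hv.trans (k1.trans (le_of_eq (by ring))), hd.trans (k2.trans (le_of_eq (by ring)))⟩

/-- **Stub GLOBAL-GROWTH — an equivariant family with polynomial `C¹` bounds on reduced sets has
polynomial `C¹` bounds on the whole cone.**  Cover the cone by `(γ t) · R(p₀)`, `γ` in the arithmetic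
stabiliser of the coset, `t ∈ T` finite (COVER-FIN (i)); by RED-BOUND `γ^{±1}` are polynomially bounded
in `E(H)`; move `H` to `(γt)⁻¹ · H ∈ R(p₀)` with the equivariance (the coset becomes `t⁻¹ • c`, finitely
many), where the reduced-set bounds hold, and control the twist `σS(diagArch (γ t))` and the linear
maps `(γt)^{±1} · ` polynomially in the entries (coefficient growth, landed `stub_coneGrowth_coeffRep`).
[cite: Borel1983Regularization, §3.5] [cite: BorelWallach2000, VII 2.2] -/
theorem stub_global_growth {n : ℕ} {K : Type} [Field K] [NumberField K]
    (hcpt : isCompact_glFiniteIntegralLevel n K) (𝔫 : Ideal (𝓞 K))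
    (S : Finset {w : InfinitePlace K // w.IsReal}) (lam : (K →+* ℂ) → Fin n → ℤ) {q : ℕ}
    (β : (FiniteAdelicGL n K ⧸ level n K 𝔫) → hermSpace n K → (hermSpace n K [⋀^Fin q]→L[ℝ] CoeffModule ℂ n K lam))
    (hβs : ∀ c, ContDiffOn ℝ ((⊤ : ℕ∞) : WithTop ℕ∞) (β c) (posCone n K))
    (hβe : ∀ (γ : GL (Fin n) K) (c : FiniteAdelicGL n K ⧸ level n K 𝔫),
        ∀ H ∈ posCone n K, ∀ v : Fin q → hermSpace n K,
        β (globalEmbedding n K γ • c) (coneActionRat n K γ H) (fun i => coneActionRat n K γ (v i)) =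
          σS hcpt S lam (ParallelWeight.diagArch K n γ) (β c H v))
    (hβb : ∀ (c : FiniteAdelicGL n K ⧸ level n K 𝔫) (c₁ C₁ τ₁ : ℝ),
        ∃ (C : ℝ) (k : ℕ), ∀ H ∈ posCone n K,
          IsReduced c₁ C₁ τ₁ n (placeFamily K (H : Matrix (Fin n) (Fin n) (mixedSpace K))) →
            ∀ (v : Fin q → hermSpace n K) (w' : hermSpace n K),
              ‖β c H v‖ ≤ C * (1 + ∑ i, ∑ j,
              (‖(H : Matrix (Fin n) (Fin n) (mixedSpace K)) i j‖ +
                ‖(H : Matrix (Fin n) (Fin n) (mixedSpace K))⁻¹ i j‖)) ^ k * ∏ i, ‖v i‖ ∧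
              ‖fderiv ℝ (β c) H w' v‖ ≤ C * (1 + ∑ i, ∑ j,
              (‖(H : Matrix (Fin n) (Fin n) (mixedSpace K)) i j‖ +
                ‖(H : Matrix (Fin n) (Fin n) (mixedSpace K))⁻¹ i j‖)) ^ k * ‖w'‖ * ∏ i, ‖v i‖) :
    ∀ c : FiniteAdelicGL n K ⧸ level n K 𝔫, ∃ (C : ℝ) (k : ℕ), ∀ H ∈ posCone n K,
      ∀ (v : Fin q → hermSpace n K) (w' : hermSpace n K),
        ‖β c H v‖ ≤ C * (1 + ∑ i, ∑ j,
              (‖(H : Matrix (Fin n) (Fin n) (mixedSpace K)) i j‖ +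
                ‖(H : Matrix (Fin n) (Fin n) (mixedSpace K))⁻¹ i j‖)) ^ k * ∏ i, ‖v i‖ ∧
        ‖fderiv ℝ (β c) H w' v‖ ≤ C * (1 + ∑ i, ∑ j,
              (‖(H : Matrix (Fin n) (Fin n) (mixedSpace K)) i j‖ +
                ‖(H : Matrix (Fin n) (Fin n) (mixedSpace K))⁻¹ i j‖)) ^ k * ‖w'‖ * ∏ i, ‖v i‖ := by
  intro c
  obtain ⟨c₀, C₀, τ₀, T, hc₀, hC₀, hτ₀, hcov⟩ := (stub_reducedCone_cover_finite n K 𝔫 c).1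
  exact global_growth_of_cover hcpt 𝔫 S lam β hβs hβe hβb c hcov
    (stub_red_bound n K 𝔫 c c₀ C₀ τ₀ hc₀ hC₀ hτ₀ T)

end Summit.Langlands.Langlands.Theorems.HeckeEigenvalueField.Res

end
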